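import Mathlib
import Summits.MatrixMultiplication.MatrixMultiplication.Theorems.LieRankDesigns.Negative.Basics

/-!
# `LieRankDesigns` (stmt-MatrixMultiplication-7614), line `Sketch`: stub A `stub_levelFixedVector` — level functions see the frame stabiliser

Crux `Summit.MatrixMultiplication.MatrixMultiplication.Theses.LevelGradedCohnUmans.LieRankDesigns`; skeleton
`Cruxes/LieRankDesigns/Lines/Sketch.lean` (lead prover-line-stmt-MatrixMultiplication-7614-0, 7 registered stubs A–G);
this file proves the registered stub `stub_levelFixedVector` verbatim (name + signature) and lands
`--supports stmt-MatrixMultiplication-7614`.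

Content. `G = GL_m(𝔽_p)`, `H_k = {h : h e_i = e_i (i < k)}` (the first `k` columns of `h` are those of `1`, a
subgroup: `exists_frameStab`), `F_k` = functions `g ↦ Σ_M c_M ψ(tr(M g))` with `c` supported on `rk M ≤ k`.  For an
irreducible character `χ = χ_ρ ∈ F_k`: if `Σ_{h ∈ H_k} χ(h) = 0` then `ρ|_{H_k}` has no invariants
(Mathlib `Representation.card_inv_mul_sum_char_eq_finrank`), so the averaging operator `Σ_{h ∈ H_k} ρ(h)`
vanishes and with it every translate `Σ_{h ∈ H_k} χ(h x)` (`sum_char_mul_eq_zero`).  A mode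
`f_M(g) = ψ(tr(M g))` with `rk M ≤ k` is right-invariant under `b⁻¹ H_k b` for any `b ∈ G` killing the rows
`≥ k` of `b M` (then `h (b M) = b M`, `frame_mul_eq`), and such a `b` exists (`exists_mul_rows_eq_zero`: a
linear automorphism moving the column space of `M` into `⟨e_0, …, e_{r-1}⟩`, `r = rk M`); averaging the
reindexed sum over `H_k` gives `Σ_g f_M(g) χ(g⁻¹) = 0` (`mode_sum_eq_zero`), hence `Σ_g χ(g) χ(g⁻¹) = 0`,
contradicting `⟨χ, χ⟩ = 1` (`IsIrrChar.classInner_eq`).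
-/

set_option linter.dupNamespace false

noncomputable section

open scoped BigOperators
open Literature.RepresentationTheory.FiniteGroups
open Summit.MatrixMultiplication.MatrixMultiplication.Theorems.LieRankDesigns.Negative
  (GLm Mat fourierFn RankSupp RankSep levelSet budget volume)

namespace Summit.MatrixMultiplication.MatrixMultiplication.Theorems.LieRankDesigns

namespace LevelFixedVector

open Module

/-! ### Linear algebra: moving a subspace into another one of the same dimension -/

/-- In a finite-dimensional vector space a subspace is moved by some linear automorphism into any
subspace of the same dimension (complements and `LinearEquiv.ofFinrankEq`). [folklore] -/
theorem exists_linearEquiv_mapsTo {K V : Type*} [Field K] [AddCommGroup V] [Module K V]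
    [FiniteDimensional K V] (W E : Submodule K V) (h : finrank K W = finrank K E) :
    ∃ φ : V ≃ₗ[K] V, ∀ w ∈ W, φ w ∈ E := by
  obtain ⟨Wc, hWc⟩ := W.exists_isCompl
  obtain ⟨Ec, hEc⟩ := E.exists_isCompl
  have hc : finrank K Wc = finrank K Ec := by
    have h1 := Submodule.finrank_add_eq_of_isCompl hWc
    have h2 := Submodule.finrank_add_eq_of_isCompl hEc
    omega
  let e₁ : W ≃ₗ[K] E := LinearEquiv.ofFinrankEq W E h
  let e₂ : Wc ≃ₗ[K] Ec := LinearEquiv.ofFinrankEq Wc Ec hc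
  refine ⟨(W.prodEquivOfIsCompl Wc hWc).symm ≪≫ₗ (e₁.prodCongr e₂) ≪≫ₗ (E.prodEquivOfIsCompl Ec hEc),
    fun w hw => ?_⟩
  have hsymm : (W.prodEquivOfIsCompl Wc hWc).symm w = (⟨w, hw⟩, 0) :=
    Submodule.prodEquivOfIsCompl_symm_apply_left (p := W) (q := Wc) hWc ⟨w, hw⟩
  simp only [LinearEquiv.trans_apply, hsymm, LinearEquiv.prodCongr_apply, map_zero,
    Submodule.coe_prodEquivOfIsCompl', Submodule.coe_zero, add_zero]
  exact (e₁ ⟨w, hw⟩).2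

/-! ### The frame stabiliser `H_k` -/

variable {p m : ℕ}

/-- If the rows `l ≥ k` of `N` vanish and the first `k` columns of `h` are those of the identity, then
`h N = N` (`(hN)_{lj} = Σ_{i<k} h_{li} N_{ij} = N_{lj}`). [folklore] -/
theorem frame_mul_eq {k : ℕ} {h N : Mat p m}
    (hh : ∀ i j : Fin m, (i : ℕ) < k → h j i = (1 : Mat p m) j i)
    (hN : ∀ l j : Fin m, k ≤ (l : ℕ) → N l j = 0) : h * N = N := by
  ext l j
  rw [Matrix.mul_apply]
  calc ∑ i, h l i * N i j = ∑ i, (1 : Mat p m) l i * N i j := by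
        refine Finset.sum_congr rfl fun i _ => ?_
        by_cases hi : (i : ℕ) < k
        · rw [hh i l hi]
        · rw [hN i j (not_lt.mp hi), mul_zero, mul_zero]
    _ = ((1 : Mat p m) * N) l j := (Matrix.mul_apply).symm
    _ = N l j := by rw [Matrix.one_mul]

/-- **The frame stabiliser `H_k ≤ GL_m(𝔽_p)` is a subgroup**: there is a subgroup whose members are exactly
the `h` whose first `k` columns are those of the identity (`h e_i = e_i` for `i < k`; closed under products
since `(ab)_{ji} = Σ_l a_{jl} δ_{li} = a_{ji}` for `i < k`, and under inverses likewise).  Stated as an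
existence theorem so that this helper file introduces no definitions. [folklore] -/
theorem exists_frameStab (p m k : ℕ) :
    ∃ H : Subgroup (GLm p m), ∀ h : GLm p m,
      h ∈ H ↔ ∀ i j : Fin m, (i : ℕ) < k → (h : Mat p m) j i = (1 : Mat p m) j i := by
  refine ⟨{ carrier := {h | ∀ i j : Fin m, (i : ℕ) < k → (h : Mat p m) j i = (1 : Mat p m) j i}
            mul_mem' := ?_
            one_mem' := ?_
            inv_mem' := ?_ }, fun h => Iff.rfl⟩
  · intro a b ha hb i j hi
    simp only [Set.mem_setOf_eq] at ha hb ⊢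
    rw [Units.val_mul, Matrix.mul_apply]
    calc ∑ l, (a : Mat p m) j l * (b : Mat p m) l i = ∑ l, (a : Mat p m) j l * (1 : Mat p m) l i := by
          refine Finset.sum_congr rfl fun l _ => ?_
          rw [hb i l hi]
      _ = ((a : Mat p m) * (1 : Mat p m)) j i := (Matrix.mul_apply).symm
      _ = (1 : Mat p m) j i := by rw [Matrix.mul_one, ha i j hi]
  · intro i j _
    rfl
  · intro a ha i j hi
    simp only [Set.mem_setOf_eq] at ha ⊢
    calc ((a⁻¹ : GLm p m) : Mat p m) j i = (((a⁻¹ : GLm p m) : Mat p m) * (1 : Mat p m)) j i := by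
          rw [Matrix.mul_one]
      _ = ∑ l, ((a⁻¹ : GLm p m) : Mat p m) j l * (1 : Mat p m) l i := Matrix.mul_apply
      _ = ∑ l, ((a⁻¹ : GLm p m) : Mat p m) j l * (a : Mat p m) l i := by
          refine Finset.sum_congr rfl fun l _ => ?_
          rw [ha i l hi]
      _ = (((a⁻¹ : GLm p m) : Mat p m) * (a : Mat p m)) j i := (Matrix.mul_apply).symm
      _ = (1 : Mat p m) j i := by rw [Units.inv_mul]

/-- The `finsum` over the inlined frame-stabiliser set is the finite sum over the frame stabiliser `H`. -/
theorem finsum_mem_setOf_eq_sum [Fact p.Prime] {k : ℕ} (H : Subgroup (GLm p m)) [Fintype H]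
    (hH : ∀ h : GLm p m, h ∈ H ↔ ∀ i j : Fin m, (i : ℕ) < k → (h : Mat p m) j i = (1 : Mat p m) j i)
    (f : GLm p m → ℂ) :
    ∑ᶠ h ∈ {h : GLm p m | ∀ i j : Fin m, (i : ℕ) < k → (h : Mat p m) j i = (1 : Mat p m) j i}, f h =
      ∑ h : H, f h := by
  rw [finsum_mem_eq_finite_toFinset_sum f (Set.toFinite _)]
  exact Finset.sum_subtype _ (fun h => by rw [Set.Finite.mem_toFinset, Set.mem_setOf_eq, hH]) f

/-! ### No `H`-invariants forces all `H`-translates of the character to vanish -/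

/-- If `Σ_{h ∈ H} χ_ρ(h) = 0` then `ρ|_H` has no invariant vectors
(`Representation.card_inv_mul_sum_char_eq_finrank`), so the averaging operator `Σ_{h ∈ H} ρ(h)` (whose
values are `H`-invariant) vanishes, and with it every translate `Σ_{h ∈ H} χ_ρ(h x) = tr((Σ_h ρ h) ρ x)`.
[folklore] -/
theorem sum_char_mul_eq_zero {G V : Type} [Group G] [AddCommGroup V] [Module ℂ V]
    [FiniteDimensional ℂ V] (ρ : Representation ℂ G V) (H : Subgroup G) [Fintype H]
    (h0 : ∑ h : H, ρ.character h = 0) (x : G) : ∑ h : H, ρ.character (h * x) = 0 := by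
  haveI : Invertible (Nat.card H : ℂ) :=
    invertibleOfNonzero (Nat.cast_ne_zero.mpr (Nat.card_pos (α := H)).ne')
  set ρH : Representation ℂ H V := ρ.comp H.subtype with hρH
  have hfin : finrank ℂ ρH.invariants = 0 := by
    have key := Representation.card_inv_mul_sum_char_eq_finrank ρH
    have hchar : ∀ g : H, ρH.character g = ρ.character g := fun g => rfl
    simp only [hchar, h0, mul_zero] at key
    exact_mod_cast key.symm
  have hbot : ρH.invariants = ⊥ := Submodule.finrank_eq_zero.mp hfin
  have hA : (∑ h : H, ρ h) = 0 := by
    ext v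
    have hmem : (∑ h : H, ρ h) v ∈ ρH.invariants := by
      rw [Representation.mem_invariants]
      intro g
      rw [LinearMap.sum_apply, map_sum]
      change ∑ h : H, ρ (g : G) (ρ (h : G) v) = ∑ h : H, ρ (h : G) v
      simp_rw [← Module.End.mul_apply, ← map_mul, ← Subgroup.coe_mul]
      exact Fintype.sum_equiv (Equiv.mulLeft g) _ _ fun h => rfl
    rw [hbot, Submodule.mem_bot] at hmem
    rw [hmem, LinearMap.zero_apply]
  calc ∑ h : H, ρ.character (h * x) = LinearMap.trace ℂ V ((∑ h : H, ρ h) * ρ x) := by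
        simp only [Representation.character, map_mul, Finset.sum_mul, map_sum]
    _ = 0 := by rw [hA, zero_mul, map_zero]

/-! ### Fourier modes of rank `≤ k` are orthogonal to such a character -/

/-- A Fourier mode adapted to the frame is orthogonal to `χ` once all `H`-translates of `χ` vanish, for a
subgroup `H` inside the frame stabiliser `H_k`: for `b` with the rows `≥ k` of `b M` zero,
`f_M(g) = ψ(tr(M g))` is right-invariant under `b⁻¹ H b` (`tr(M g u) = tr(u M g)`, `u M = M` by
`frame_mul_eq`), and averaging the reindexed sum over `H` gives
`|H| · Σ_g f_M(g) χ(g⁻¹) = Σ_g f_M(g) Σ_{h ∈ H} χ(h · b g⁻¹ b⁻¹) = 0`. -/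
theorem mode_sum_eq_zero [Fact p.Prime] {k : ℕ} (χ : GLm p m → ℂ)
    (hcl : ∀ x y : GLm p m, χ (x * y) = χ (y * x)) (H : Subgroup (GLm p m)) [Fintype H]
    (hHk : ∀ h ∈ H, ∀ i j : Fin m, (i : ℕ) < k → (h : Mat p m) j i = (1 : Mat p m) j i)
    (hH : ∀ x : GLm p m, ∑ h : H, χ (h * x) = 0) {M : Mat p m} {b : GLm p m}
    (hb : ∀ l j : Fin m, k ≤ (l : ℕ) → ((b : Mat p m) * M) l j = 0) :
    ∑ s : GLm p m, ZMod.stdAddChar (Matrix.trace (M * (s : Mat p m))) * χ s⁻¹ = 0 := by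
  set S := ∑ s : GLm p m, ZMod.stdAddChar (Matrix.trace (M * (s : Mat p m))) * χ s⁻¹ with hS
  have key : ∀ h : H, S = ∑ t : GLm p m,
      ZMod.stdAddChar (Matrix.trace (M * (t : Mat p m))) * χ ((h : GLm p m) * (b * t⁻¹ * b⁻¹)) := by
    intro h
    have huM : ((b⁻¹ * (h : GLm p m)⁻¹ * b : GLm p m) : Mat p m) * M = M := by
      rw [Units.val_mul, Units.val_mul, Matrix.mul_assoc, Matrix.mul_assoc,
        frame_mul_eq (hHk _ (H.inv_mem h.2)) hb, Units.inv_mul_cancel_left]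
    rw [hS]
    refine (Fintype.sum_equiv (Equiv.mulRight (b⁻¹ * (h : GLm p m)⁻¹ * b)) _ _ fun t => ?_).symm
    simp only [Equiv.coe_mulRight]
    congr 1
    · rw [Units.val_mul, ← Matrix.mul_assoc, Matrix.trace_mul_cycle, huM]
    · calc χ ((h : GLm p m) * (b * t⁻¹ * b⁻¹))
            = χ ((h : GLm p m) * b * t⁻¹ * b⁻¹) := by congr 1; group
        _ = χ (b⁻¹ * ((h : GLm p m) * b * t⁻¹)) := (hcl _ _).symm
        _ = χ (t * (b⁻¹ * (h : GLm p m)⁻¹ * b))⁻¹ := by congr 1; group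
  have hcard : (Fintype.card H : ℂ) * S = 0 := by
    rw [← nsmul_eq_mul, ← Finset.card_univ, ← Finset.sum_const,
      Finset.sum_congr rfl fun h _ => key h, Finset.sum_comm]
    refine Finset.sum_eq_zero fun t _ => ?_
    rw [← Finset.mul_sum, hH, mul_zero]
  exact (mul_eq_zero.mp hcard).resolve_left (Nat.cast_ne_zero.mpr Fintype.card_ne_zero)

/-- For `rk M ≤ k` some `b ∈ GL_m(𝔽_p)` kills the rows `≥ k` of `b M`: a linear automorphism moving the
column space of `M` (dimension `rk M`) into the span of the first `rk M` standard basis vectors. [folklore] -/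
theorem exists_mul_rows_eq_zero [Fact p.Prime] {k : ℕ} (M : Mat p m) (hM : M.rank ≤ k) :
    ∃ b : GLm p m, ∀ l j : Fin m, k ≤ (l : ℕ) → ((b : Mat p m) * M) l j = 0 := by
  have hrm : M.rank ≤ m := M.rank_le_width
  -- the target: the span `E` of the first `rk M` standard basis vectors
  let v : Fin M.rank → (Fin m → ZMod p) := fun i => Pi.basisFun (ZMod p) (Fin m) (Fin.castLE hrm i)
  have hv : LinearIndependent (ZMod p) v :=
    (Pi.basisFun (ZMod p) (Fin m)).linearIndependent.comp (Fin.castLE hrm) (Fin.castLE_injective hrm)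
  let E : Submodule (ZMod p) (Fin m → ZMod p) := Submodule.span (ZMod p) (Set.range v)
  have hE : finrank (ZMod p) E = M.rank := by
    rw [finrank_span_eq_card hv, Fintype.card_fin]
  have hW : finrank (ZMod p) (LinearMap.range M.mulVecLin) = M.rank := rfl
  obtain ⟨φ, hφ⟩ := exists_linearEquiv_mapsTo (LinearMap.range M.mulVecLin) E (hW.trans hE.symm)
  -- vectors of `E` vanish in the coordinates `≥ k`
  have hEk : ∀ w ∈ E, ∀ l : Fin m, k ≤ (l : ℕ) → w l = 0 := by
    intro w hw l hl
    induction hw using Submodule.span_induction with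
    | mem x hx =>
      obtain ⟨i, rfl⟩ := hx
      have hi := i.isLt
      have hne : l ≠ Fin.castLE hrm i := fun h => by
        have := congrArg Fin.val h
        rw [Fin.val_castLE] at this
        omega
      show Pi.basisFun (ZMod p) (Fin m) (Fin.castLE hrm i) l = 0
      rw [Pi.basisFun_apply]
      exact Pi.single_eq_of_ne hne 1
    | zero => rfl
    | add x y _ _ hx hy => rw [Pi.add_apply, hx, hy, add_zero]
    | smul a x _ hx => rw [Pi.smul_apply, hx, smul_zero]
  -- the matrix of `φ` is invertible
  have hmul : LinearMap.toMatrix' (φ : (Fin m → ZMod p) →ₗ[ZMod p] (Fin m → ZMod p)) *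
      LinearMap.toMatrix' (φ.symm : (Fin m → ZMod p) →ₗ[ZMod p] (Fin m → ZMod p)) = 1 := by
    rw [← LinearMap.toMatrix'_comp, LinearEquiv.comp_symm, LinearMap.toMatrix'_id]
  have hunit : IsUnit (LinearMap.toMatrix' (φ : (Fin m → ZMod p) →ₗ[ZMod p] (Fin m → ZMod p))) :=
    (Matrix.isUnit_iff_isUnit_det _).mpr (Matrix.isUnit_det_of_right_inverse hmul)
  refine ⟨hunit.unit, fun l j hl => ?_⟩
  rw [hunit.unit_spec]
  have hcol : (LinearMap.toMatrix' (φ : (Fin m → ZMod p) →ₗ[ZMod p] (Fin m → ZMod p)) * M) l j =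
      (φ : (Fin m → ZMod p) →ₗ[ZMod p] (Fin m → ZMod p)) (M.mulVec (Pi.single j 1)) l := by
    rw [← LinearMap.toMatrix'_mulVec, Matrix.mulVec_mulVec, Matrix.mulVec_single_one]
    rfl
  rw [hcol]
  exact hEk _ (hφ _ (LinearMap.mem_range_self M.mulVecLin (Pi.single j 1))) l hl

end LevelFixedVector

open LevelFixedVector in
/-- **Stub A `LevelFixedVector`** (registered signature, `IsFrameFix` inlined).  For an irreducible character
`χ` of `GL_m(𝔽_p)` lying in the level `F_k`, `Σ_{h ∈ H_k} χ(h) ≠ 0`, i.e. `ρ_χ` has a non-zero `H_k`-fixed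
vector (`H_k` = the `h` whose first `k` columns are those of `1`).  Proof: were the sum `0`, all
`H_k`-translates `Σ_h χ(h x)` would vanish (`sum_char_mul_eq_zero`); every Fourier mode of rank `≤ k` is then
orthogonal to `χ` (`mode_sum_eq_zero` with the frame `exists_mul_rows_eq_zero`), so `Σ_g χ(g) χ(g⁻¹) = 0`,
contradicting `⟨χ, χ⟩ = 1` (`IsIrrChar.classInner_eq`).  The hypotheses `1 ≤ k ≤ m` are not needed. -/
theorem stub_levelFixedVector :
    ∀ (p m k : ℕ) [Fact p.Prime], 1 ≤ k → k ≤ m →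
      ∀ χ ∈ irrChars (GLm p m) ∩ levelSet p m k,
        (∑ᶠ h ∈ {h : GLm p m | ∀ i j : Fin m, (i : ℕ) < k → (h : Mat p m) j i = (1 : Mat p m) j i}, χ h)
          ≠ 0 := by
  intro p m k _ _ _ χ hχ
  obtain ⟨hirr, c, hc, hχc⟩ := hχ
  obtain ⟨H, hHmem⟩ := exists_frameStab p m k
  classical
  rw [finsum_mem_setOf_eq_sum H hHmem]
  intro hzero
  obtain ⟨V, _, _, _, ρ, -, rfl⟩ := id hirr
  -- all `H_k`-translates of `χ` vanish
  have hH : ∀ x : GLm p m, ∑ h : H, ρ.character (h * x) = 0 :=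
    sum_char_mul_eq_zero ρ H hzero
  -- hence `Σ_g χ(g) χ(g⁻¹) = 0`, mode by mode
  have hinner : ∑ s : GLm p m, ρ.character s * ρ.character s⁻¹ = 0 := by
    calc ∑ s : GLm p m, ρ.character s * ρ.character s⁻¹
          = ∑ s : GLm p m, ∑ M : Mat p m,
              c M * (ZMod.stdAddChar (Matrix.trace (M * (s : Mat p m))) * ρ.character s⁻¹) := by
            refine Finset.sum_congr rfl fun s _ => ?_
            rw [hχc s]
            simp only [fourierFn, Finset.sum_mul, mul_assoc]
        _ = ∑ M : Mat p m, c M * ∑ s : GLm p m,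
              ZMod.stdAddChar (Matrix.trace (M * (s : Mat p m))) * ρ.character s⁻¹ := by
            rw [Finset.sum_comm]
            simp only [Finset.mul_sum]
        _ = 0 := Finset.sum_eq_zero fun M _ => by
            by_cases hMk : k < M.rank
            · rw [hc M hMk, zero_mul]
            · obtain ⟨b, hb⟩ := exists_mul_rows_eq_zero M (not_lt.mp hMk)
              rw [mode_sum_eq_zero ρ.character (fun x y => ρ.char_mul_comm y x) H
                (fun h hh => (hHmem h).mp hh) hH hb, mul_zero]
  -- contradiction with `⟨χ, χ⟩ = 1`
  have h1 := IsIrrChar.classInner_eq hirr hirr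
  rw [if_pos rfl, classInner_apply, hinner, mul_zero] at h1
  exact zero_ne_one h1

end Summit.MatrixMultiplication.MatrixMultiplication.Theorems.LieRankDesigns

end
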